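import Literature.AnabelianGeometry.EtaleTheta.ThetaSubquotientOfTemperedTwistAut
import Literature.AnabelianGeometry.EtaleTheta.ThetaSubquotientOfTemperedAutIso
import Literature.AnabelianGeometry.EtaleTheta.Discharge.Sec5TransportLaws
import Literature.AnabelianGeometry.SemiGraphs.TemperoidsGaloisObjectsProofs

/-!
# [EtTh] §5 / Thm. 5.6: the Δ-TRANSPORT of `(l·Δ_Θ)_(−)` along a self-equivalence `Ψ^bs ≅ B^temp(φ)` of `B^temp(Π)⁰` —
# `(l·Δ_Θ)_E ⥲ (l·Δ_Θ)_{B^temp(φ)(E)} ⥲ (l·Δ_Θ)_{Ψ^bs(E)}`, its naturality, its agreement with `Aut`, and `⊗ ℤ/Nℤ` (T56-L03 step 2, carrier level)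

Mochizuki, *The étale theta function and its Frobenioid-theoretic manifestations*, Publ. RIMS **45** (2009), §5 p.327 (PDF p.101) («`(l·Δ_Θ)_D`
… preserved by arbitrary self-equivalences of `D`»), Thm. 5.6 proof p.329 (PDF p.103) l.1 («it follows from Propositions 2.4, 2.6 that `Ψ`
preserves "`(l·Δ_Θ)_{(−)}`"»), Prop. 5.5 proof p.328 (PDF p.102) («induce isomorphisms … `⊗ ℤ/Nℤ`») [cite: MochizukiEtTh2009, §5 p.327 (PDF p.101)];
S. Mochizuki, *Semi-graphs of anabelioids* (2006), Prop. 3.2 p.35 (`Ψ^bs ≅ B^temp(φ)`; tree: `BTemp.exists_res_iso_of_connectedPart_equivalence`).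

abc-iut cell, layer L2, seat abc-iut-w5-d013 (gen 4), ROW «T56-L03 step 2» (carrier level).  CLASS (b) CONSTRUCTION over abc-iut-L2-t9's carrier
(DEFS-FREEZE rules 04:46:23Z): new definitions `mapEquiv` / `transportTwist` / `modPowEquiv` (MulEquiv's), no structure field, no instance,
no notation, no new named Prop fact.  This is the DATA binder `aΨ` of abc-iut-L2-d4's Thm. 5.6 (`Discharge/Sec5Thm56`) at the level of
`B^temp(Π)⁰`: step 2 at the §5 data (`aΨ` for abc-iut-L2-t4's `ofConnectedTemperoidData` with `Q := RigidData.levelStub`, `haΨn`, the T56-L09c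
law) instantiates these at `F := Ψ^bs`, `ηE := ` the components of the [SemiAnbd] Prop. 3.2 iso composed with `eΨ`.
* `ThetaSubquotient.mapEquiv` — t9's transport `map` along an ISOMORPHISM of connected objects, as a `MulEquiv` (`map_comp`, `map_id`);
* **`ThetaSubquotient.transportTwist q ι φ φQ φΛ hq hι E F ηE : LDelta q ι E.obj ≃* LDelta q ι F.obj`** for connected-part objects `E`, `F`
  and an identification `ηE : F.obj ≅ B^temp(φ)(E.obj)` (objectwise shape of `Ψ^bs ⋙ ι ≅ ι ⋙ B^temp(φ)`): `twist` followed by `map ηE⁻¹`;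
* `ThetaSubquotient.map_transportTwist` — NATURALITY along `f : E → E′`, `g : F → F′` with `g ≫ ηE′ = ηE ≫ B^temp(φ)(f)` (the naturality
  square of `Ψ^bs ⋙ ι ≅ ι ⋙ B^temp(φ)`): `map g ∘ transportTwist_E = transportTwist_{E′} ∘ map f` (`map_twist` + `map_comp`);
* `ThetaSubquotient.transportTwist_autProj` — agreement with print's subquotient of `Aut`: `transportTwist (autProj_E σ) =
  autProj_F (ηE⁻¹-conjugate of B^temp(φ)(σ))` (`twist_autProj` + `map_autProj_iso`);
* `ThetaSubquotient.modPowEquiv` — «`⊗ ℤ/Nℤ`» of a `MulEquiv` (`QuotientGroup.congr`), with `modPowEquiv_mk` and its compatibility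
  `modPowMap_modPowEquiv` with t9's `modPowMap`.
HONEST FRAMING: definitions + kernel-checked lemmas about abc-iut-L2-t9's carrier; nothing about the curves of [EtTh] is asserted; no side
taken on [IUTchIII] Cor. 3.12.
-/

noncomputable section

namespace Literature.AnabelianGeometry.EtaleTheta

namespace ThetaSubquotient

open CategoryTheory Literature.AlgebraicGeometry.Frobenioids Literature.AnabelianGeometry.SemiGraphs
open Literature.AlgebraicGeometry.Frobenioids.QuasiTemperoid (stabilizerSubgroup)

universe u v w

variable {G : Type u} [Group G] [TopologicalSpace G] {Q : Type v} [Group Q] {Λ : Type w}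
  [CommGroup Λ] (q : G →* Q) (ι : Λ →* Q) [ι.range.Normal]

/-! ### Transport along an isomorphism as a `MulEquiv` -/

/-- **t9's `map` along an ISOMORPHISM of connected objects, as an isomorphism `(l·Δ_Θ)_E ⥲ (l·Δ_Θ)_{E′}`** (inverse: `map` along the
inverse; `map_comp`, `map_id`). [cite: MochizukiEtTh2009, Prop 5.5 proof p.328 (PDF p.102)] -/
def mapEquiv {E E' : BTemp G} (hE : IsConnectedObj E) (hE' : IsConnectedObj E') (i : E ≅ E') : LDelta q ι E ≃* LDelta q ι E' where
  toFun := map q ι hE hE' i.hom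
  invFun := map q ι hE' hE i.inv
  left_inv x := by
    change ((map q ι hE' hE i.inv).comp (map q ι hE hE' i.hom)) x = x
    rw [← map_comp, Iso.hom_inv_id, map_id, MonoidHom.id_apply]
  right_inv x := by
    change ((map q ι hE hE' i.hom).comp (map q ι hE' hE i.inv)) x = x
    rw [← map_comp, Iso.inv_hom_id, map_id, MonoidHom.id_apply]
  map_mul' := map_mul _

/-- `mapEquiv i` is `map i.hom`. [cite: MochizukiEtTh2009, Prop 5.5 proof p.328 (PDF p.102)] -/
@[simp] theorem mapEquiv_apply {E E' : BTemp G} (hE : IsConnectedObj E) (hE' : IsConnectedObj E') (i : E ≅ E') (x : LDelta q ι E) :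
    mapEquiv q ι hE hE' i x = map q ι hE hE' i.hom x := rfl

/-- `(mapEquiv i)⁻¹` is `map i.inv`. [cite: MochizukiEtTh2009, Prop 5.5 proof p.328 (PDF p.102)] -/
@[simp] theorem mapEquiv_symm_apply {E E' : BTemp G} (hE : IsConnectedObj E) (hE' : IsConnectedObj E') (i : E ≅ E')
    (y : LDelta q ι E') : (mapEquiv q ι hE hE' i).symm y = map q ι hE' hE i.inv y := rfl

/-! ### The Δ-transport along `Ψ^bs ≅ B^temp(φ)` -/

variable (φ : G ≃ₜ* G) (φQ : Q ≃* Q) (φΛ : Λ ≃* Λ) (hq : ∀ g : G, q (φ g) = φQ (q g)) (hι : ∀ a : Λ, ι (φΛ a) = φQ (ι a))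

omit [ι.range.Normal] in
/-- `B^temp(φ)(E)` is connected when identified with a connected-part object. [cite: MochizukiSemiAnbd2006, Rmk 3.1.3 p.34] -/
theorem isConnectedObj_res_of_iso (E F : ConnectedPart (BTemp G)) (ηE : F.obj ≅ (BTemp.res (φ : G →ₜ* G)).obj E.obj) :
    IsConnectedObj ((BTemp.res (φ : G →ₜ* G)).obj E.obj) :=
  GaloisObjects.isConnectedObj_of_iso ηE.symm F.property

/-- **The Δ-transport `(l·Δ_Θ)_E ⥲ (l·Δ_Θ)_F` along a self-equivalence of `B^temp(Π)⁰` at an object**: for connected-part objects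
`E`, `F` with an identification `ηE : F ≅ B^temp(φ)(E)` (objectwise shape of `Ψ^bs ⋙ ι ≅ ι ⋙ B^temp(φ)`, [SemiAnbd] Prop. 3.2), the
`twist` along `φ` followed by t9's transport along `ηE⁻¹`. [cite: MochizukiEtTh2009, Thm 5.6 proof p.329 (PDF p.103)] -/
def transportTwist (E F : ConnectedPart (BTemp G)) (ηE : F.obj ≅ (BTemp.res (φ : G →ₜ* G)).obj E.obj) :
    LDelta q ι E.obj ≃* LDelta q ι F.obj :=
  (twist q ι φ φQ φΛ hq hι E.obj).trans
    (mapEquiv q ι (isConnectedObj_res_of_iso φ E F ηE) F.property ηE.symm)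

/-- `transportTwist` unfolded: `map ηE⁻¹ ∘ twist`. [cite: MochizukiEtTh2009, Thm 5.6 proof p.329 (PDF p.103)] -/
theorem transportTwist_apply (E F : ConnectedPart (BTemp G)) (ηE : F.obj ≅ (BTemp.res (φ : G →ₜ* G)).obj E.obj)
    (x : LDelta q ι E.obj) :
    transportTwist q ι φ φQ φΛ hq hι E F ηE x =
      map q ι (isConnectedObj_res_of_iso φ E F ηE) F.property ηE.inv (twist q ι φ φQ φΛ hq hι E.obj x) := rfl

/-- **NATURALITY of the Δ-transport** along the naturality square of `Ψ^bs ⋙ ι ≅ ι ⋙ B^temp(φ)`: for `f : E → E′`, `g : F → F′` with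
`g ≫ ηE′ = ηE ≫ B^temp(φ)(f)`, `map g ∘ transportTwist_E = transportTwist_{E′} ∘ map f` — abc-iut-L2-d4's binder `haΨn` at the level of
`B^temp(Π)⁰`. [cite: MochizukiEtTh2009, Thm 5.6 proof p.329 (PDF p.103)] -/
theorem map_transportTwist {E E' F F' : ConnectedPart (BTemp G)} (ηE : F.obj ≅ (BTemp.res (φ : G →ₜ* G)).obj E.obj)
    (ηE' : F'.obj ≅ (BTemp.res (φ : G →ₜ* G)).obj E'.obj) (f : E.obj ⟶ E'.obj) (g : F.obj ⟶ F'.obj)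
    (hη : g ≫ ηE'.hom = ηE.hom ≫ (BTemp.res (φ : G →ₜ* G)).map f) (x : LDelta q ι E.obj) :
    map q ι F.property F'.property g (transportTwist q ι φ φQ φΛ hq hι E F ηE x) =
      transportTwist q ι φ φQ φΛ hq hι E' F' ηE' (map q ι E.property E'.property f x) := by
  have hEr := isConnectedObj_res_of_iso φ E F ηE
  have hE'r := isConnectedObj_res_of_iso φ E' F' ηE'
  have hη' : ηE.inv ≫ g = (BTemp.res (φ : G →ₜ* G)).map f ≫ ηE'.inv := by
    rw [Iso.inv_comp_eq, ← Category.assoc, Iso.eq_comp_inv, hη]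
  rw [transportTwist_apply, transportTwist_apply, ← map_twist q ι φ φQ φΛ hq hι E.property E'.property f hEr hE'r,
    ← MonoidHom.comp_apply, ← map_comp q ι hEr F.property F'.property, hη', map_comp q ι hEr hE'r F'.property, MonoidHom.comp_apply]

/-- **Agreement with print's subquotient of `Aut`**: for `σ ∈ autPre E`, `transportTwist (autProj_E σ) = autProj_F (ηE⁻¹ ∘ B^temp(φ)(σ) ∘ ηE)` —
the Δ-transport and the transport of `Aut_D(−)` induced by `Ψ^bs` coincide on `Aut`'s subquotient (carrier-level T56-L09c).
[cite: MochizukiEtTh2009, Thm 5.6 proof p.329 (PDF p.103)] -/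
theorem transportTwist_autProj (E F : ConnectedPart (BTemp G)) (ηE : F.obj ≅ (BTemp.res (φ : G →ₜ* G)).obj E.obj)
    (σ : autPre q ι E.obj) :
    transportTwist q ι φ φQ φΛ hq hι E F ηE (autProj q ι E.obj σ) =
      autProj q ι F.obj ⟨ηE.symm.conjAut ((BTemp.res (φ : G →ₜ* G)).mapIso (σ : Aut E.obj)),
        conjAut_mem_autPre q ι ηE.symm (mapIso_res_mem_autPre q ι φ φQ φΛ hq hι E.obj σ.2)⟩ := by
  have hEr := isConnectedObj_res_of_iso φ E F ηE
  rw [transportTwist_apply, twist_autProj q ι φ φQ φΛ hq hι E.obj hEr σ]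
  exact map_autProj_iso q ι hEr F.property ηE.symm ⟨_, mapIso_res_mem_autPre q ι φ φQ φΛ hq hι E.obj σ.2⟩

/-! ### «`⊗ ℤ/Nℤ`» of an isomorphism -/

omit [ι.range.Normal] in
/-- `N`-th powers correspond under an isomorphism of abelian groups. [cite: MochizukiEtTh2009, Def 5.4 p.327 (PDF p.101)] -/
theorem map_range_powMonoidHom {A B : Type w} [CommGroup A] [CommGroup B] (e : A ≃* B) (N : ℕ) :
    (powMonoidHom N : A →* A).range.map e.toMonoidHom = (powMonoidHom N : B →* B).range := by
  ext b
  constructor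
  · rintro ⟨_, ⟨a, rfl⟩, rfl⟩
    exact ⟨e a, by simp [map_pow]⟩
  · rintro ⟨b, rfl⟩
    exact ⟨e.symm b ^ N, ⟨e.symm b, rfl⟩, by simp [map_pow]⟩

omit [ι.range.Normal] in
/-- **`A ⊗ ℤ/Nℤ ⥲ B ⊗ ℤ/Nℤ` induced by an isomorphism `A ⥲ B`** («induce isomorphisms … `⊗ ℤ/Nℤ`», p.328 (PDF p.102)).
[cite: MochizukiEtTh2009, Prop 5.5 proof p.328 (PDF p.102)] -/
def modPowEquiv {A B : Type w} [CommGroup A] [CommGroup B] (e : A ≃* B) (N : ℕ) : ModPow A N ≃* ModPow B N :=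
  QuotientGroup.congr _ _ e (map_range_powMonoidHom e N)

omit [ι.range.Normal] in
/-- `modPowEquiv` on classes. [cite: MochizukiEtTh2009, Prop 5.5 proof p.328 (PDF p.102)] -/
@[simp] theorem modPowEquiv_mk {A B : Type w} [CommGroup A] [CommGroup B] (e : A ≃* B) (N : ℕ) (a : A) :
    modPowEquiv e N (QuotientGroup.mk a) = QuotientGroup.mk (e a) := rfl

omit [ι.range.Normal] in
/-- `modPowEquiv e` is t9's `modPowMap` of the underlying homomorphism. [cite: MochizukiEtTh2009, Prop 5.5 proof p.328 (PDF p.102)] -/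
theorem modPowEquiv_eq_modPowMap {A B : Type w} [CommGroup A] [CommGroup B] (e : A ≃* B) (N : ℕ) (x : ModPow A N) :
    modPowEquiv e N x = modPowMap e.toMonoidHom N x := by
  induction x using QuotientGroup.induction_on with
  | H a => rfl

omit [ι.range.Normal] in
/-- **Functoriality «`⊗ ℤ/Nℤ`»**: `modPowMap g ∘ modPowEquiv e = modPowEquiv e′ ∘ modPowMap f` whenever `g ∘ e = e′ ∘ f`.
[cite: MochizukiEtTh2009, Prop 5.5 proof p.328 (PDF p.102)] -/
theorem modPowMap_modPowEquiv {A B A' B' : Type w} [CommGroup A] [CommGroup B] [CommGroup A'] [CommGroup B'] (e : A ≃* B)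
    (e' : A' ≃* B') (f : A →* A') (g : B →* B') (h : ∀ a, g (e a) = e' (f a)) (N : ℕ) (x : ModPow A N) :
    modPowMap g N (modPowEquiv e N x) = modPowEquiv e' N (modPowMap f N x) := by
  induction x using QuotientGroup.induction_on with
  | H a => exact congrArg QuotientGroup.mk (h a)

end ThetaSubquotient

end Literature.AnabelianGeometry.EtaleTheta

end
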